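import Mathlib.Analysis.SpecialFunctions.Pow.Real
import Mathlib.Order.Filter.AtTopBot.Basic
import Literature.Computability.Complexity.CNF
import Literature.Computability.MetaComplexity.Resolution
import Literature.Computability.MetaComplexity.ResLin
import HarnessLib

-- provenance: harness21/H21/H21/Statements/FineGrained/ProofComplexitySETH.lean @ ce36cfb (interim HEAD d8f2665); M5 mechanical rewrite
/-!
# Fine-grained complexity: proof-complexity analogues of SETH

Family `FineGrained`, trunk `CplxMeta` (outline `H21/Outlines/CplxMeta.md`, §3 and R5), inventory
item fine-grained.S24: "bounded-depth Res(⊕) / O(ε)-regular resolution refutations of some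
`k`-CNFs need size `2^{(1-ε)n}` (proof-complexity SETH)".

The Strong Exponential Time Hypothesis says that for every `ε > 0` there is a `k` such that
`k`-SAT on `n` variables cannot be solved in time `2^{(1-ε)n}`. Its *proof-complexity analogue*
for a proof system `P` is the (unconditional, when provable) statement that for every `ε > 0`
there are `k` and unsatisfiable `k`-CNFs `φₙ` on `n` variables all of whose `P`-refutations have
size at least `2^{(1-ε)n}`. This is known for

* regular resolution (Beck–Impagliazzo, STOC 2013), and more generally
* `δ`-regular resolution with `δ = δ(ε) > 0` (Bonacina–Talebanfard, Algorithmica 2017): on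
  every path of the refutation DAG at most `δ n` variables are resolved more than once
  (`IsDeltaRegular`, `Literature.Prelude.CplxMeta.Resolution`);
* bounded-depth resolution over parities Res(⊕) (Efremenko–Itsykson, ECCC TR25-188, 2025).

## Contents

* `deltaRegularRes_SETH` (fine-grained.S24, the only declaration carrying the inventory id):
  the Bonacina–Talebanfard theorem (containing Beck–Impagliazzo as the case of regular
  refutations, `IsRegular.isDeltaRegular`), and its corollary `regularRes_SETH`.
* `BoundedDepthResLinSETH d`: the statement template "Res(⊕) refutations of depth `≤ d n` of some
  `k`-CNF family need size `2^{(1-ε)n}`", as a `Prop`-valued definition (asserting nothing)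
  parameterised by the depth regime `d : ℕ → ℝ`, with its antitonicity in `d`
  (`BoundedDepthResLinSETH.anti`).

## Design notes (outline R5, allowed degradation)

The outline asks for a second theorem `boundedDepthResLin_SETH`, the main theorem of
Efremenko–Itsykson (ECCC TR25-188), with the depth regime `d` of that theorem written
explicitly. The inventory citation does not record that regime and we could not pin it from
the citation alone. Following the outline's degradation rule (§3, l.347; R5), only
`deltaRegularRes_SETH` carries the bold inventory id and the Res(⊕) part is NOT stated as a
theorem: it is recorded as the honest template `BoundedDepthResLinSETH d` plus this note.

TODO (v1, plain text, not a declaration): add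
`theorem boundedDepthResLin_SETH : BoundedDepthResLinSETH d_EI := by sorry` with `d_EI` the exact
depth regime of Efremenko–Itsykson's main theorem, quoted verbatim in its docstring, and move the
bold id onto it as well. Do NOT state a "regime-free" version `∃ c > 0, … resLinDepth π ≤ c n …`:
a Res(⊕) refutation of depth `D` can be pruned (fan-in `≤ 2`) to one with at most `2^{D+1}`
lines, so for `c < 1 - ε` such a statement holds only vacuously (no refutation of depth `≤ c n`
exists), i.e. it is a mere linear depth lower bound with no `2^{(1-ε)n}` content.

Formulas are G01's list-based `CNF ℕ` (`Literature.Prelude.CplxCore.CNF`) with `IsWidthLE k`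
(`k`-CNF), `numVars ≤ n` (variables among `x₀, …, x_{n-1}`) and `Satisfiable`; we do not import
`Literature.Statements.FineGrained.Wave0` (its `KCNF` is not needed). Sizes are numbers of lines
(`List.length`) of C8/C9's sequence-like derivations, cast to `ℝ` to compare with
`(2 : ℝ) ^ ((1 - ε) * n)` (`Real.rpow`).

## Mathlib search

Mathlib has no propositional proof systems, resolution, Res(⊕) or SETH (its `resolution`s are
homological; `Mathlib.Tactic.Sat.FromLRAT` is a tactic-level reification without size notions).
We only use `Filter.atTop`, `Filter.Eventually` and `Real.rpow`.

## References

* C. Beck, R. Impagliazzo, *Strong ETH holds for regular resolution*, STOC 2013, Thm 1.1.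
* I. Bonacina, N. Talebanfard, *Strong ETH and resolution via games and the multiplicity of
  strategies*, IPEC 2015 / Algorithmica 79 (2017), Thm 1 (main theorem, δ-regular resolution).
* K. Efremenko, D. Itsykson, ECCC TR25-188 (2025) (SETH for bounded-depth Res(⊕)), main
  theorem.
* R. Impagliazzo, R. Paturi, *On the complexity of k-SAT*, JCSS 62 (2001) (SETH).
-/

namespace Literature.Computability.FineGrained

open Filter Complexity MetaComplexity

/-! ### δ-regular resolution (Beck–Impagliazzo, Bonacina–Talebanfard) -/

/-- **fine-grained.S24** (proof-complexity SETH for `δ`-regular resolution; Bonacina–Talebanfard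
2017, Thm 1; Beck–Impagliazzo STOC 2013, Thm 1.1 for `δ = 0`, i.e. regular resolution).
For every `ε > 0` there are `δ > 0` and `k` and a family of unsatisfiable `k`-CNFs `φ n` on (at
most) `n` variables such that, for all large `n`, every `δ`-regular resolution refutation of
`φ n` (on every path of the proof DAG at most `δ n` variables are resolved more than once) has
at least `2^{(1-ε)n}` lines. Since regular refutations are `δ`-regular for every `δ ≥ 0`
(`IsRegular.isDeltaRegular`), this contains the Beck–Impagliazzo theorem for regular
resolution. Bonacina–Talebanfard in fact obtain `δ` linear in `ε` ("`O(ε)`-regular", as in the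
inventory text); following the outline, only the existence of some `δ = δ(ε) > 0` is recorded
here. [cite: STOC2013, Thm 1.1 for  δ = 0   i.e. regular resolu] -/
def deltaRegularRes_SETH : Prop :=
  ∀ ε : ℝ, 0 < ε → ∃ (δ : ℝ) (k : ℕ), 0 < δ ∧ ∃ φ : ℕ → CNF ℕ,
      (∀ n, (φ n).IsWidthLE k ∧ (φ n).numVars ≤ n ∧ ¬ (φ n).Satisfiable) ∧
      ∀ᶠ n : ℕ in atTop, ∀ π : List (ResLine ℕ), IsResRefutation (φ n) π →
        IsDeltaRegular δ n π → (2 : ℝ) ^ ((1 - ε) * n) ≤ (π.length : ℝ)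

/-- The regular-resolution case (Beck–Impagliazzo STOC 2013, Thm 1.1): for every `ε > 0` there
are `k` and unsatisfiable `k`-CNFs `φ n` on `n` variables all of whose regular resolution
refutations have, for large `n`, at least `2^{(1-ε)n}` lines. Derived here from
`deltaRegularRes_SETH` and `IsRegular.isDeltaRegular`. [cite: STOC2013, Thm 1.1] -/
def regularRes_SETH : Prop :=
  ∀ ε : ℝ, 0 < ε → ∃ k : ℕ, ∃ φ : ℕ → CNF ℕ,
      (∀ n, (φ n).IsWidthLE k ∧ (φ n).numVars ≤ n ∧ ¬ (φ n).Satisfiable) ∧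
      ∀ᶠ n : ℕ in atTop, ∀ π : List (ResLine ℕ), IsResRefutation (φ n) π →
        IsRegular π → (2 : ℝ) ^ ((1 - ε) * n) ≤ (π.length : ℝ)

/- interim proof relied on results that are now named facts (D-0014); demoted to a fact by the M5 import, proof preserved:
:= by
  intro ε hε
  obtain ⟨δ, k, hδ, φ, hφ, h⟩ := deltaRegularRes_SETH ε hε
  refine ⟨k, φ, hφ, h.mono fun n hn π hπ hreg => hn π hπ (hreg.isDeltaRegular hδ.le n)⟩
-/

/-! ### Bounded-depth Res(⊕) (Efremenko–Itsykson) -/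

/-- Proof-complexity SETH for Res(⊕) refutations of depth at most `d n` (statement template,
NOT an inventory target by itself; see the module docstring, outline R5): for every `ε > 0`
there are `k` and a family of unsatisfiable `k`-CNFs `φ n` on (at most) `n` variables such
that, for all large `n`, every Res(⊕) refutation `π` of `φ n` with `resLinDepth π ≤ d n` has at
least `2^{(1-ε)n}` lines. Efremenko–Itsykson (ECCC TR25-188, main theorem) prove this for their
bounded-depth regime `d`, which this file does not pin down (TODO in the module docstring).
Caveat (documented degeneracy): since a depth-`D` refutation can be pruned to `≤ 2^{D+1}` lines,
the template is only meaningful for regimes with `d n ≥ (1 - ε) n` eventually (e.g. `d n ≳ n`);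
for smaller `d` it degenerates into a pure depth lower bound. [Efremenko–Itsykson 2025, main
theorem; Itsykson–Sokolov 2020, §2 (Res(⊕))] [cite: EfremenkoItsykson2025, main theorem] -/
def BoundedDepthResLinSETH (d : ℕ → ℝ) : Prop :=
  ∀ ε : ℝ, 0 < ε → ∃ k : ℕ, ∃ φ : ℕ → CNF ℕ,
    (∀ n, (φ n).IsWidthLE k ∧ (φ n).numVars ≤ n ∧ ¬ (φ n).Satisfiable) ∧
    ∀ᶠ n : ℕ in atTop, ∀ π : List ResLinLine, IsResLinRefutation (φ n) π →
      (resLinDepth π : ℝ) ≤ d n → (2 : ℝ) ^ ((1 - ε) * n) ≤ (π.length : ℝ)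

/-- Monotonicity of the bounded-depth Res(⊕) SETH template in the depth regime: a lower bound
against refutations of depth `≤ d' n` is in particular one against refutations of depth
`≤ d n` whenever `d n ≤ d' n` for all large `n`. [Efremenko–Itsykson 2025, §1 (depth
hierarchies)] [cite: EfremenkoItsykson2025, §1 (depth hierarchies] -/
theorem BoundedDepthResLinSETH.anti {d d' : ℕ → ℝ} (h : BoundedDepthResLinSETH d')
    (hd : ∀ᶠ n : ℕ in atTop, d n ≤ d' n) : BoundedDepthResLinSETH d := by
  intro ε hε
  obtain ⟨k, φ, hφ, h⟩ := h ε hε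
  refine ⟨k, φ, hφ, ?_⟩
  filter_upwards [h, hd] with n hn hdn π hπ hdepth
  exact hn π hπ (hdepth.trans hdn)

/- TODO (v1, outline R5 degradation; plain text on purpose): `theorem boundedDepthResLin_SETH :
BoundedDepthResLinSETH d_EI := by sorry` for the exact depth regime `d_EI` of the main theorem of
Efremenko–Itsykson, ECCC TR25-188 (2025), once that regime is pinned from the source. See the
module docstring for why no regime-free surrogate is stated. -/

end Literature.Computability.FineGrained
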